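import Mathlib
import HarnessLib
import Literature.AlgebraicGeometry.Ramification.InertiaNormalSylow
import Literature.AlgebraicGeometry.Resolution.RegularCentreBlowupSeqExtension
import Summits.ResolutionOfSingularities.ResolutionOfSingularities.Theorems.WildQuotientsWildQuotientResolutionPrimeOrbitSeparationPhaseZero

/-!
# Phase 0 in EVERY dimension when the inertia groups are ℓ-conjugacy-thin (no blow-up needed for separation)
# (crux `WildQuotients.WildQuotientResolution`, stub `stub_phaseZeroHighDim`)

Crux stmt-ResolutionOfSingularities-15640 (`WildQuotientResolution`), registered stub `stub_phaseZeroHighDim`.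
✓`phaseZero_of_primeOrbitSeparation` (p822966) asks for a model separating the inert loci of distinct conjugate
subgroups of prime order `ℓ ≠ p`. The separation holds ON `X′` ITSELF exactly when no inertia group contains two
distinct `G`-conjugate subgroups of the same prime order `ℓ ≠ p` («ℓ-conjugacy-thin inertia»). Hence:

**Theorem** (`phaseZero_of_thinInertia`). For the crux datum with faithful `ρ`, if for every point `y`, every
element `a` of prime order `ℓ ≠ p` and every `x ∈ G`, `⟨a⟩ ≤ I_y` and `⟨xax⁻¹⟩ ≤ I_y` imply `⟨a⟩ = ⟨xax⁻¹⟩`, then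
the conclusion of `stub_phaseZeroHighDim` holds in every dimension (the orbit moves run on `X′` directly). This
contains all previous normal-core slices (a normal `⟨a⟩` has no other conjugates) and, e.g., actions whose inertia
groups have CYCLIC or normal Sylow `ℓ`-subgroups for every `ℓ ≠ p` with a unique subgroup of order `ℓ` per inertia
group.

[OURS · crux stmt-ResolutionOfSingularities-15640 · helper toward `stub_phaseZeroHighDim` (an all-dimensional SLICE;
NOT a proof of the stub); counted 0; AI-level work, weaker than expert review.] [folklore]
-/

-- single-problem summit: the doubled namespace component `ResolutionOfSingularities` is forced
set_option linter.dupNamespace false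

noncomputable section

open CategoryTheory AlgebraicGeometry TopologicalSpace IsLocalRing
open Literature.AlgebraicGeometry.Resolution Literature.AlgebraicGeometry.Ramification
open Summit.ResolutionOfSingularities.ResolutionOfSingularities.Theorems.WildQuotientResolution
open Summit.ResolutionOfSingularities.ResolutionOfSingularities.Theorems.WildQuotientResolution.InertLocusStalk

namespace Summit.ResolutionOfSingularities.ResolutionOfSingularities.Theorems.WildQuotientResolution.StandardForm

/-- **Phase 0 for ℓ-conjugacy-thin inertia** (crux stmt-ResolutionOfSingularities-15640, a SLICE of
`stub_phaseZeroHighDim`; any dimension). See the module docstring. [folklore] -/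
theorem phaseZero_of_thinInertia (p : ℕ) (hp : p.Prime) (k : Type) [Field k] [CharP k p]
    (X' X₁ : Scheme.{0}) (f : X₁ ⟶ Spec (.of k)) (q : X' ⟶ X₁) (G : Type) [Group G] [Finite G]
    (ρ : G →* Aut X') (hfaith : Function.Injective ρ)
    [IsSeparated f] [LocallyOfFiniteType f] [QuasiCompact f] [IsIntegral X']
    (hreg : Scheme.IsRegular X') [IsFinite q] (hρ : ∀ g : G, (ρ g).hom ≫ q = q)
    (hthin : ∀ (y : X') (a : G), (orderOf a).Prime → (orderOf a).Coprime p → ∀ x : G,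
      Subgroup.zpowers a ≤ inertiaSubgroup ρ y → Subgroup.zpowers (x * a * x⁻¹) ≤ inertiaSubgroup ρ y →
      Subgroup.zpowers a = Subgroup.zpowers (x * a * x⁻¹)) :
    ∃ (Xs : Scheme.{0}) (π : Xs ⟶ X') (ρs : G →* Aut Xs), IsProper π ∧ IsBirational π ∧
      IsIntegral Xs ∧ Scheme.IsRegular Xs ∧ (∀ g : G, (ρs g).hom ≫ π = π ≫ (ρ g).hom) ∧
      (∀ x : Xs, HasNormalSylow p (inertiaSubgroup ρs x)) ∧
      ∀ x : Xs, ∃ U : Xs.Opens, IsAffineOpen U ∧ x ∈ U ∧ ∀ g : G, (ρs g).hom ⁻¹ᵁ U = U := by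
  obtain ⟨-, hcov⟩ := iterHypotheses_of_cruxData X' X₁ f q ρ hρ
  refine phaseZero_of_primeOrbitSeparation p hp k X' X₁ f q G ρ hρ X' (𝟙 X') ρ (isBirational_id X') hreg hfaith
    (fun g => by simp) hcov fun a ha hap x hne => ?_
  rw [Set.disjoint_iff]
  rintro y ⟨h1, h2⟩
  exact hne (hthin y a ha hap x h1 h2)

end Summit.ResolutionOfSingularities.ResolutionOfSingularities.Theorems.WildQuotientResolution.StandardForm

end
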